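import Summits.BirchSwinnertonDyer.BirchSwinnertonDyer.Theorems.ManinLocalTwoThreeEtaIdentitiesFiftySix
import Summits.BirchSwinnertonDyer.BirchSwinnertonDyer.Theorems.ManinLocalTwoThreeEtaLimitKFiftySix
import HarnessLib

/-!
# Level 56, the second newform: the identity (K) `(P−Q)²(U+2)²(U²−3U+4) = (P+Q)²(U⁴−3U³+12U²−12U+16)` EXACTLY, and
# (S2)₅₆_b: `Λ(P + Q) ⊆ Λ(4/3, 440/27)` — the Néron lattice shape of `56b1 = [0, −1, 0, 0, −4]`

Cell bsd-f2-manin, route `ManinLocalTwoThree` (crux C2 `ManinOddAtFour`, stmt-22967: `2² ∣ 56`), prover seat p2 gen 28.  The two newforms of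
level `56` are `56a = P − Q` and `56b = P + Q` (`NewformPinningFiftySix`).  With `U = x_a + 1` (the `η`-quotient `x`-coordinate of `56a1`,
`EtaMonomialsFiftySix`) the `x`-coordinate of the optimal parametrisation `X₀(56) → 56b1` is `x_b = U + 4/U − 2` (degree `8`; fibre over `O`
= `{∞, 1/4, 1/8, 1/28}`, the zeros of `U` lying at `1/4`, `1/28`), and the whole analytic content of `56b1` beyond that of `56a1` is ONE
identity of weight `4`:

* §1 a weight-`4` cusp-form constructor: for `φ, ψ ∈ S₂(Γ₀(N))` and holomorphic `Γ₀(N)`-invariant `x, y`, the function `φ²x − ψ²y` is a cusp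
  form of weight `4` as soon as it tends to `0` at every cusp (`(φ²x − ψ²y)|₄A = (φ|₂A)²·x∘A − (ψ|₂A)²·y∘A`);
* §2 **(K)₅₆ exactly**: `(P−Q)²(U+2)²(U²−3U+4) − (P+Q)²(U⁴−3U³+12U²−12U+16) ∈ S₄(Γ₀(56))` (at the cusps with `8 ∤ c`: `U` bounded, `(P±Q)|A → 0`;
  at the class of `1/8`: `(P∓Q)|₂A₀ = ±(P∓Q)∘β⁻¹/7`, `U∘A₀ = U∘β⁻¹` by the Atkin–Lehner `η`-device) with `S/q²⁶ → 0` (`EtaLimitKFiftySix`), hence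
  `0` by the cuspidal Sturm bound `⌊4·96/12⌋ + 1 = 33 < 26 + 8`;
* §3 **(S2)₅₆_b**: with `X = U + 4U⁻¹ − 7/3` (`U⁻¹` the inverse `η`-quotient, holomorphic on `ℍ`), (I2a)/(I1) of `EtaIdentitiesFiftySix` and
  (K) give `(X′)² = (2πi(P+Q))²(4X³ − (4/3)X − 440/27)`; `4X³ − (4/3)X − 440/27 = 4(U−2)²(U⁴−…+16)/U³` is not identically `0`; so
  `Λ(P + Q) ⊆ Λ(L₁)` with `g₂(L₁) = 4/3 = c₄/12`, `g₃(L₁) = 440/27 = c₆/216` (`56b1`: `c₄ = 16`, `c₆ = 3520`).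

No definition, no named fact, no sorry; nothing here proves C2, Manin's conjecture or BSD. [cite: Ligozat1975, Ch. 3–4]
[cite: CremonaAlgorithms1997, Table 1 (56b1), §2.10] [cite: DiamondShurman2005, §1.2, Thm. 3.5.1]
-/

set_option autoImplicit false
-- lint-debt: the directory name repeats the summit name (sibling precedent `ManinLocalTwoThreeEtaIdentitiesFiftySix.lean`)
set_option linter.dupNamespace false

noncomputable section

open Complex Filter Topology Set Function Asymptotics
open UpperHalfPlane hiding I
open scoped Real Topology Manifold MatrixGroups ModularForm
open ModularForm CongruenceSubgroup
open Literature.NumberTheory.ModularForms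
open Literature.NumberTheory.EllipticCurves Literature.NumberTheory.EllipticCurves.ModularForms

namespace Summit.BirchSwinnertonDyer.BirchSwinnertonDyer.Theorems.ManinLocalTwoThree.EtaIdentityKFiftySix

open CuspToolkit AnalyticBridge EtaIdentityReductionThirtySix AtkinLehnerEtaFiftySix AtkinLehnerCuspFiftySix NewformsFiftySix
  EtaIdentitiesFiftySix EtaMonomialsFiftySix
open NewformFortyEight (slash_mapGL)

/-! ## §1 A weight-`4` cusp-form constructor -/

section General

variable {N : ℕ} [NeZero N]

omit [NeZero N] in
/-- `(φ²x − ψ²y)|₄A = (φ|₂A)²·x∘A − (ψ|₂A)²·y∘A`. [cite: DiamondShurman2005, §1.2] -/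
theorem slash_four_apply (φ ψ : CuspForm (Gamma0 N) 2) (x y : ℍ → ℂ) (A : SL(2, ℤ)) (τ : ℍ) :
    ((fun σ : ℍ ↦ φ σ ^ 2 * x σ - ψ σ ^ 2 * y σ) ∣[(4 : ℤ)] A) τ
      = (⇑φ ∣[(2 : ℤ)] A) τ ^ 2 * x (A • τ) - (⇑ψ ∣[(2 : ℤ)] A) τ ^ 2 * y (A • τ) := by
  rw [SL_slash_apply, SL_slash_apply, SL_slash_apply]
  have hJ := UpperHalfPlane.denom_ne_zero (A : GL (Fin 2) ℝ) τ
  rw [zpow_neg, zpow_neg, zpow_ofNat, zpow_ofNat]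
  field_simp

/-- **`φ²x − ψ²y` is a cusp form of weight `4` on `Γ₀(N)`** when `φ, ψ ∈ S₂(Γ₀(N))`, `x, y` are holomorphic and `Γ₀(N)`-invariant, it tends to `0`
at `i∞` along every `A ∉ Γ₀(N)` and at `i∞` itself. [cite: DiamondShurman2005, §1.2] -/
theorem exists_cuspForm_four (φ ψ : CuspForm (Gamma0 N) 2) (x y : ℍ → ℂ) (hx : MDifferentiable 𝓘(ℂ) 𝓘(ℂ) x)
    (hy : MDifferentiable 𝓘(ℂ) 𝓘(ℂ) y)
    (hxinv : ∀ γ : SL(2, ℤ), γ ∈ Gamma0 N → ∀ τ : ℍ, x (γ • τ) = x τ)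
    (hyinv : ∀ γ : SL(2, ℤ), γ ∈ Gamma0 N → ∀ τ : ℍ, y (γ • τ) = y τ)
    (hzero : ∀ A : SL(2, ℤ), A ∉ Gamma0 N → IsZeroAtImInfty ((fun σ : ℍ ↦ φ σ ^ 2 * x σ - ψ σ ^ 2 * y σ) ∣[(4 : ℤ)] A))
    (h0 : IsZeroAtImInfty (fun σ : ℍ ↦ φ σ ^ 2 * x σ - ψ σ ^ 2 * y σ)) :
    ∃ S : CuspForm (Gamma0 N) 4, ∀ τ : ℍ, S τ = φ τ ^ 2 * x τ - ψ τ ^ 2 * y τ := by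
  have hslashΓ : ∀ γ : SL(2, ℤ), γ ∈ Gamma0 N →
      ((fun σ : ℍ ↦ φ σ ^ 2 * x σ - ψ σ ^ 2 * y σ) ∣[(4 : ℤ)] γ) = fun σ : ℍ ↦ φ σ ^ 2 * x σ - ψ σ ^ 2 * y σ := by
    intro γ hγ
    funext τ
    have hφ : (⇑φ ∣[(2 : ℤ)] γ) = ⇑φ := by
      have h := SlashInvariantForm.slash_action_eqn φ _ ⟨γ, hγ, rfl⟩
      rw [SL_slash]; exact h
    have hψ : (⇑ψ ∣[(2 : ℤ)] γ) = ⇑ψ := by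
      have h := SlashInvariantForm.slash_action_eqn ψ _ ⟨γ, hγ, rfl⟩
      rw [SL_slash]; exact h
    rw [slash_four_apply, hφ, hψ, hxinv γ hγ τ, hyinv γ hγ τ]
  refine ⟨{ toFun := fun σ : ℍ ↦ φ σ ^ 2 * x σ - ψ σ ^ 2 * y σ
            slash_action_eq' := ?_
            holo' := ?_
            zero_at_cusps' := ?_ }, fun τ ↦ rfl⟩
  · intro A hA
    obtain ⟨γ, hγ, rfl⟩ := hA
    rw [slash_mapGL]
    exact hslashΓ γ hγ
  · exact (((CuspFormClass.holo φ).pow 2).mul hx).sub (((CuspFormClass.holo ψ).pow 2).mul hy)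
  · intro c hc
    rw [Subgroup.IsArithmetic.isCusp_iff_isCusp_SL2Z] at hc
    rw [OnePoint.isZeroAt_iff_forall_SL2Z hc]
    intro A _
    show IsZeroAtImInfty ((fun σ : ℍ ↦ φ σ ^ 2 * x σ - ψ σ ^ 2 * y σ) ∣[(4 : ℤ)] A)
    by_cases hA : A ∈ Gamma0 N
    · rw [hslashΓ A hA]; exact h0
    · exact hzero A hA

/-- At a cusp where `x∘A`, `y∘A` are bounded, `(φ²x − ψ²y)|₄A → 0`. [cite: DiamondShurman2005, §1.2] -/
theorem isZeroAtImInfty_slash_four_of_bounded (φ ψ : CuspForm (Gamma0 N) 2) (x y : ℍ → ℂ) (A : SL(2, ℤ))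
    (hxb : IsBoundedAtImInfty (fun τ : ℍ ↦ x (A • τ))) (hyb : IsBoundedAtImInfty (fun τ : ℍ ↦ y (A • τ))) :
    IsZeroAtImInfty ((fun σ : ℍ ↦ φ σ ^ 2 * x σ - ψ σ ^ 2 * y σ) ∣[(4 : ℤ)] A) := by
  have hfun : ((fun σ : ℍ ↦ φ σ ^ 2 * x σ - ψ σ ^ 2 * y σ) ∣[(4 : ℤ)] A)
      = fun τ : ℍ ↦ (⇑φ ∣[(2 : ℤ)] A) τ * (⇑φ ∣[(2 : ℤ)] A) τ * x (A • τ) + -((⇑ψ ∣[(2 : ℤ)] A) τ * (⇑ψ ∣[(2 : ℤ)] A) τ * y (A • τ)) := by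
    funext τ; rw [slash_four_apply]; ring
  rw [hfun]
  have hφ : IsZeroAtImInfty (⇑φ ∣[(2 : ℤ)] A) := CuspFormClass.zero_at_infty_slash φ A
  have hψ : IsZeroAtImInfty (⇑ψ ∣[(2 : ℤ)] A) := CuspFormClass.zero_at_infty_slash ψ A
  exact ((hφ.mul_boundedAtFilter hφ.boundedAtFilter).mul_boundedAtFilter hxb).add
    ((hψ.mul_boundedAtFilter hψ.boundedAtFilter).mul_boundedAtFilter hyb).neg

end General

/-! ## §2 (K)₅₆ exactly -/

section PhiPsi

variable (φ ψ : CuspForm (Gamma0 56) 2)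
  (hφ : ⇑φ = fun τ ↦ etaQuotient 56 (expFn [(2, -1), (4, 3), (14, 3), (28, -1)]) τ
      - etaQuotient 56 (expFn [(2, 3), (4, -1), (14, -1), (28, 3)]) τ)
  (hψ : ⇑ψ = fun τ ↦ etaQuotient 56 (expFn [(2, -1), (4, 3), (14, 3), (28, -1)]) τ
      + etaQuotient 56 (expFn [(2, 3), (4, -1), (14, -1), (28, 3)]) τ)

include hψ in
/-- `(P + Q)|₂A₀ = −(P + Q)∘β⁻¹/7` for `A₀ = (1 0; 8 1)`: the newform `56b` has `W₇`-sign `−1`. [cite: AtkinLehner1970, Thm. 3] -/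
theorem psi_slash_A0 (A₀ : SL(2, ℤ)) (h00 : A₀ 0 0 = 1) (h01 : A₀ 0 1 = 0) (h10 : A₀ 1 0 = 8) (h11 : A₀ 1 1 = 1) (σ : ℍ) :
    (⇑ψ ∣[(2 : ℤ)] A₀) σ = -(1 / 7 : ℂ) * ψ (affPt 1 1 7 one_pos (by norm_num) σ) := by
  have hj := eight_mul_add_one_ne_zero σ
  have h10' : ((A₀ 1 0 : ℤ) : ℂ) = 8 := by exact_mod_cast h10
  have h11' : ((A₀ 1 1 : ℤ) : ℂ) = 1 := by exact_mod_cast h11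
  rw [SL_slash_apply, ModularGroup.denom_apply, hψ, h10', h11']
  simp only
  rw [P_A0_smul A₀ h00 h01 h10 h11 σ, Q_A0_smul A₀ h00 h01 h10 h11 σ, zpow_neg, zpow_ofNat]
  field_simp
  ring

include hφ hψ in
/-- **(K)₅₆: `(P−Q)²(U+2)²(U²−3U+4) = (P+Q)²(U⁴−3U³+12U²−12U+16)` on `ℍ`** (with `φ = P − Q`, `ψ = P + Q`): the difference is a cusp form of weight
`4` on `Γ₀(56)` with `S/q²⁶ → 0`, hence `0`. [cite: CremonaAlgorithms1997, Table 1 (56a1, 56b1)] [cite: DiamondShurman2005, Thm. 3.5.1] -/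
theorem identityK (τ : ℍ) :
    φ τ ^ 2 * ((etaQuotient 56 (expFn [(2, -1), (4, 3), (8, -2), (14, -1), (28, 3), (56, -2)]) τ + 2) ^ 2
        * (etaQuotient 56 (expFn [(2, -1), (4, 3), (8, -2), (14, -1), (28, 3), (56, -2)]) τ ^ 2
          - 3 * etaQuotient 56 (expFn [(2, -1), (4, 3), (8, -2), (14, -1), (28, 3), (56, -2)]) τ + 4))
    = ψ τ ^ 2 * (etaQuotient 56 (expFn [(2, -1), (4, 3), (8, -2), (14, -1), (28, 3), (56, -2)]) τ ^ 4
        - 3 * etaQuotient 56 (expFn [(2, -1), (4, 3), (8, -2), (14, -1), (28, 3), (56, -2)]) τ ^ 3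
        + 12 * etaQuotient 56 (expFn [(2, -1), (4, 3), (8, -2), (14, -1), (28, 3), (56, -2)]) τ ^ 2
        - 12 * etaQuotient 56 (expFn [(2, -1), (4, 3), (8, -2), (14, -1), (28, 3), (56, -2)]) τ + 16) := by
  set U : ℍ → ℂ := etaQuotient 56 (expFn [(2, -1), (4, 3), (8, -2), (14, -1), (28, 3), (56, -2)]) with hU
  set x : ℍ → ℂ := fun σ ↦ (U σ + 2) ^ 2 * (U σ ^ 2 - 3 * U σ + 4) with hx
  set y : ℍ → ℂ := fun σ ↦ U σ ^ 4 - 3 * U σ ^ 3 + 12 * U σ ^ 2 - 12 * U σ + 16 with hy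
  have hUmd : MDifferentiable 𝓘(ℂ) 𝓘(ℂ) U := mdifferentiable_etaQuotient 56 _
  have hxmd : MDifferentiable 𝓘(ℂ) 𝓘(ℂ) x :=
    ((hUmd.add mdifferentiable_const).pow 2).mul (((hUmd.pow 2).sub (hUmd.const_smul (3 : ℂ))).add mdifferentiable_const)
  have hymd : MDifferentiable 𝓘(ℂ) 𝓘(ℂ) y :=
    ((((hUmd.pow 4).sub ((hUmd.pow 3).const_smul (3 : ℂ))).add ((hUmd.pow 2).const_smul (12 : ℂ))).sub
      (hUmd.const_smul (12 : ℂ))).add mdifferentiable_const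
  have hUs : ∀ γ : SL(2, ℤ), γ ∈ Gamma0 56 → ∀ τ : ℍ, U (γ • τ) = U τ := fun γ hγ τ ↦ by rw [hU]; exact U_smul γ hγ τ
  have hxinv : ∀ γ : SL(2, ℤ), γ ∈ Gamma0 56 → ∀ τ : ℍ, x (γ • τ) = x τ := fun γ hγ τ ↦ by
    show (U (γ • τ) + 2) ^ 2 * (U (γ • τ) ^ 2 - 3 * U (γ • τ) + 4) = (U τ + 2) ^ 2 * (U τ ^ 2 - 3 * U τ + 4)
    rw [hUs γ hγ τ]
  have hyinv : ∀ γ : SL(2, ℤ), γ ∈ Gamma0 56 → ∀ τ : ℍ, y (γ • τ) = y τ := fun γ hγ τ ↦ by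
    show U (γ • τ) ^ 4 - 3 * U (γ • τ) ^ 3 + 12 * U (γ • τ) ^ 2 - 12 * U (γ • τ) + 16 = U τ ^ 4 - 3 * U τ ^ 3 + 12 * U τ ^ 2 - 12 * U τ + 16
    rw [hUs γ hγ τ]
  -- `S/q²⁶ → 0` and `S → 0` at `i∞`
  have hlim : Tendsto (fun τ : ℍ ↦ (φ τ ^ 2 * x τ - ψ τ ^ 2 * y τ) / Function.Periodic.qParam 1 (τ : ℂ) ^ 26) atImInfty (𝓝 0) := by
    have h := EtaLimitKFiftySix.tendsto_K
    refine h.congr fun τ ↦ ?_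
    simp only [hφ, hψ, hx, hy, hU]
    ring
  have h0 : IsZeroAtImInfty (fun τ : ℍ ↦ φ τ ^ 2 * x τ - ψ τ ^ 2 * y τ) := by
    have hq : Tendsto (fun τ : ℍ ↦ Function.Periodic.qParam 1 (τ : ℂ) ^ 26) atImInfty (𝓝 0) := by
      simpa only [zpow_natCast] using tendsto_qParam_zpow_atImInfty (m := ((26 : ℕ) : ℤ)) (by norm_num)
    have h := hlim.mul hq
    rw [zero_mul] at h
    exact h.congr fun τ ↦ div_mul_cancel₀ _ (pow_ne_zero _ (Complex.exp_ne_zero _))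
  -- the cusps
  have hzero : ∀ A : SL(2, ℤ), A ∉ Gamma0 56 → IsZeroAtImInfty ((fun σ : ℍ ↦ φ σ ^ 2 * x σ - ψ σ ^ 2 * y σ) ∣[(4 : ℤ)] A) := by
    intro A hA
    by_cases h8 : (8 : ℤ) ∣ A 1 0
    · refine isZeroAtImInfty_slash_of_cusp_eighth _ 4 ?_ ?_ h8 hA
      · intro γ hγ
        funext τ
        have hφγ : (⇑φ ∣[(2 : ℤ)] γ) = ⇑φ := by
          have h := SlashInvariantForm.slash_action_eqn φ _ ⟨γ, hγ, rfl⟩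
          rw [SL_slash]; exact h
        have hψγ : (⇑ψ ∣[(2 : ℤ)] γ) = ⇑ψ := by
          have h := SlashInvariantForm.slash_action_eqn ψ _ ⟨γ, hγ, rfl⟩
          rw [SL_slash]; exact h
        rw [slash_four_apply, hφγ, hψγ, hxinv γ hγ τ, hyinv γ hγ τ]
      · intro A₀ h00 h01 h10 h11
        have hfun : ((fun σ : ℍ ↦ φ σ ^ 2 * x σ - ψ σ ^ 2 * y σ) ∣[(4 : ℤ)] A₀)
            = fun σ : ℍ ↦ (1 / 49 : ℂ) * (φ (affPt 1 1 7 one_pos (by norm_num) σ) ^ 2 * x (affPt 1 1 7 one_pos (by norm_num) σ)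
              - ψ (affPt 1 1 7 one_pos (by norm_num) σ) ^ 2 * y (affPt 1 1 7 one_pos (by norm_num) σ)) := by
          funext σ
          have hUA : U (A₀ • σ) = U (affPt 1 1 7 one_pos (by norm_num) σ) := by rw [hU]; exact U_A0_smul A₀ h00 h01 h10 h11 σ
          rw [slash_four_apply, phi_slash_A0 φ hφ A₀ h00 h01 h10 h11 σ, psi_slash_A0 ψ hψ A₀ h00 h01 h10 h11 σ]
          show _ * ((U (A₀ • σ) + 2) ^ 2 * (U (A₀ • σ) ^ 2 - 3 * U (A₀ • σ) + 4))
              - _ * (U (A₀ • σ) ^ 4 - 3 * U (A₀ • σ) ^ 3 + 12 * U (A₀ • σ) ^ 2 - 12 * U (A₀ • σ) + 16) = _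
          rw [hUA]
          ring
        rw [hfun]
        have h1 := (isZeroAtImInfty_comp_affPt h0).const_mul (1 / 49 : ℂ)
        rw [mul_zero] at h1
        exact h1
    · have hUb : IsBoundedAtImInfty (fun τ : ℍ ↦ U (A • τ)) := isBoundedAtImInfty_U_smul h8
      have hc : ∀ c : ℂ, IsBoundedAtImInfty (fun _ : ℍ ↦ c) := fun c ↦ const_boundedAtFilter atImInfty c
      have hU2 : IsBoundedAtImInfty (fun τ : ℍ ↦ U (A • τ) * U (A • τ)) := hUb.mul hUb
      have hU3 : IsBoundedAtImInfty (fun τ : ℍ ↦ U (A • τ) * U (A • τ) * U (A • τ)) := hU2.mul hUb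
      have hU4 : IsBoundedAtImInfty (fun τ : ℍ ↦ U (A • τ) * U (A • τ) * U (A • τ) * U (A • τ)) := hU3.mul hUb
      have hUp2 : IsBoundedAtImInfty (fun τ : ℍ ↦ U (A • τ) + 2) := hUb.add (hc 2)
      have hq : IsBoundedAtImInfty (fun τ : ℍ ↦ U (A • τ) * U (A • τ) - 3 * U (A • τ) + 4) :=
        (hU2.sub (hUb.const_mul_left 3)).add (hc 4)
      have hxb : IsBoundedAtImInfty (fun τ : ℍ ↦ x (A • τ)) :=
        ((hUp2.mul hUp2).mul hq).congr_left fun τ ↦ by simp only [hx, Pi.mul_apply]; ring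
      have hyb : IsBoundedAtImInfty (fun τ : ℍ ↦ y (A • τ)) :=
        ((((hU4.sub (hU3.const_mul_left 3)).add (hU2.const_mul_left 12)).sub (hUb.const_mul_left 12)).add (hc 16)).congr_left
          fun τ ↦ by simp only [hy]; ring
      exact isZeroAtImInfty_slash_four_of_bounded φ ψ x y A hxb hyb
  obtain ⟨S, hS⟩ := exists_cuspForm_four φ ψ x y hxmd hymd hxinv hyinv hzero h0
  have hS0 : S = 0 := cuspForm_four_fiftySix_eq_zero_of_tendsto S (hlim.congr fun τ ↦ by rw [hS τ])
  have h := hS τ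
  rw [hS0, CuspForm.zero_apply] at h
  have h' : φ τ ^ 2 * ((U τ + 2) ^ 2 * (U τ ^ 2 - 3 * U τ + 4)) - ψ τ ^ 2 * (U τ ^ 4 - 3 * U τ ^ 3 + 12 * U τ ^ 2 - 12 * U τ + 16) = 0 :=
    h.symm
  linear_combination h'

/-! ## §3 (S2)₅₆_b: `Λ(P + Q) ⊆ Λ(4/3, 440/27)` -/

/-- `U⁻¹ = η₂η₈²η₁₄η₅₆²/(η₄³η₂₈³) = q²E₂E₈²E₁₄E₅₆²/(E₄³E₂₈³)` (the inverse `η`-quotient). [folklore] -/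
theorem Uinv56_eq (τ : ℍ) :
    etaQuotient 56 (expFn [(2, 1), (4, -3), (8, 2), (14, 1), (28, -3), (56, 2)]) τ
      = Function.Periodic.qParam 1 (τ : ℂ) ^ 2 * eulerFn 2 τ * eulerFn 8 τ ^ 2 * eulerFn 14 τ * eulerFn 56 τ ^ 2
        / (eulerFn 4 τ ^ 3 * eulerFn 28 τ ^ 3) := by
  have hE4 := eulerFn_ne_zero (by norm_num : 0 < 4) τ
  have hE28 := eulerFn_ne_zero (by norm_num : 0 < 28) τ
  have hq := QRemainder.qParam_ne_zero τ
  rw [EulerRemainders.etaQuotient_eq_cexp_mul_prod, show Nat.divisors 56 = {1, 2, 4, 7, 8, 14, 28, 56} by decide]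
  have hsum : (∑ δ ∈ ({1, 2, 4, 7, 8, 14, 28, 56} : Finset ℕ),
      (δ : ℤ) * expFn [(2, 1), (4, -3), (8, 2), (14, 1), (28, -3), (56, 2)] δ) = ((24 * 2 : ℕ) : ℤ) := by decide
  rw [hsum, EulerRemaindersSixtyFour.cexp_eq_qParam_pow]
  repeat rw [Finset.prod_insert (by decide)]
  rw [Finset.prod_singleton]
  rw [show expFn [(2, 1), (4, -3), (8, 2), (14, 1), (28, -3), (56, 2)] 1 = 0 by decide,
    show expFn [(2, 1), (4, -3), (8, 2), (14, 1), (28, -3), (56, 2)] 2 = 1 by decide,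
    show expFn [(2, 1), (4, -3), (8, 2), (14, 1), (28, -3), (56, 2)] 4 = (-3) by decide,
    show expFn [(2, 1), (4, -3), (8, 2), (14, 1), (28, -3), (56, 2)] 7 = 0 by decide,
    show expFn [(2, 1), (4, -3), (8, 2), (14, 1), (28, -3), (56, 2)] 8 = 2 by decide,
    show expFn [(2, 1), (4, -3), (8, 2), (14, 1), (28, -3), (56, 2)] 14 = 1 by decide,
    show expFn [(2, 1), (4, -3), (8, 2), (14, 1), (28, -3), (56, 2)] 28 = (-3) by decide,
    show expFn [(2, 1), (4, -3), (8, 2), (14, 1), (28, -3), (56, 2)] 56 = 2 by decide]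
  simp only [zpow_neg, zpow_ofNat]
  field_simp

/-- `U⁻¹·U = 1`: the inverse `η`-quotient is the pointwise inverse (both never vanish on `ℍ`). [folklore] -/
theorem Uinv_eq_inv (τ : ℍ) :
    etaQuotient 56 (expFn [(2, 1), (4, -3), (8, 2), (14, 1), (28, -3), (56, 2)]) τ
      = (etaQuotient 56 (expFn [(2, -1), (4, 3), (8, -2), (14, -1), (28, 3), (56, -2)]) τ)⁻¹ := by
  have := eulerFn_ne_zero (by norm_num : 0 < 2) τ; have := eulerFn_ne_zero (by norm_num : 0 < 4) τ
  have := eulerFn_ne_zero (by norm_num : 0 < 8) τ; have := eulerFn_ne_zero (by norm_num : 0 < 14) τ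
  have := eulerFn_ne_zero (by norm_num : 0 < 28) τ; have := eulerFn_ne_zero (by norm_num : 0 < 56) τ
  have hq := QRemainder.qParam_ne_zero τ
  rw [Uinv56_eq, U56_eq]
  field_simp

/-- `U⁻¹` is `Γ₀(56)`-invariant (Newman). [folklore] -/
theorem Uinv_smul (γ : SL(2, ℤ)) (hγ : γ ∈ Gamma0 56) (τ : ℍ) :
    etaQuotient 56 (expFn [(2, 1), (4, -3), (8, 2), (14, 1), (28, -3), (56, 2)]) (γ • τ)
      = etaQuotient 56 (expFn [(2, 1), (4, -3), (8, 2), (14, 1), (28, -3), (56, 2)]) τ := by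
  rw [Uinv_eq_inv, Uinv_eq_inv, U_smul γ hγ τ]

/-- Non-degeneracy on `X = U + 4U⁻¹ − 7/3`: `4X³ − (4/3)X − 440/27 = 4(U − 2)²(U⁴−3U³+12U²−12U+16)/U³` is not identically `0`
(else `(Uq²)⁶ → 1` and `→ 0`). [folklore] -/
theorem exists_Xb_nondegenerate :
    ∃ τ₀ : ℍ, 4 * (etaQuotient 56 (expFn [(2, -1), (4, 3), (8, -2), (14, -1), (28, 3), (56, -2)]) τ₀
        + 4 * etaQuotient 56 (expFn [(2, 1), (4, -3), (8, 2), (14, 1), (28, -3), (56, 2)]) τ₀ - 7 / 3) ^ 3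
      - (4 / 3 : ℂ) * (etaQuotient 56 (expFn [(2, -1), (4, 3), (8, -2), (14, -1), (28, 3), (56, -2)]) τ₀
        + 4 * etaQuotient 56 (expFn [(2, 1), (4, -3), (8, 2), (14, 1), (28, -3), (56, 2)]) τ₀ - 7 / 3) - 440 / 27 ≠ 0 := by
  by_contra hne
  push Not at hne
  set U : ℍ → ℂ := etaQuotient 56 (expFn [(2, -1), (4, 3), (8, -2), (14, -1), (28, 3), (56, -2)]) with hU
  have hU0 : ∀ τ : ℍ, U τ ≠ 0 := fun τ ↦ etaQuotient_ne_zero 56 _ τ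
  -- the sextic relation `U⁶ = 7U⁵ − 28U⁴ + 72U³ − 112U² + 112U − 64`
  have hx6 : ∀ τ : ℍ, U τ ^ 6 = 7 * U τ ^ 5 - 28 * U τ ^ 4 + 72 * U τ ^ 3 - 112 * U τ ^ 2 + 112 * U τ - 64 := by
    intro τ
    have hu := hU0 τ
    have hinv : etaQuotient 56 (expFn [(2, 1), (4, -3), (8, 2), (14, 1), (28, -3), (56, 2)]) τ = (U τ)⁻¹ := by
      rw [hU]; exact Uinv_eq_inv τ
    have hid : 4 * (U τ + 4 * etaQuotient 56 (expFn [(2, 1), (4, -3), (8, 2), (14, 1), (28, -3), (56, 2)]) τ - 7 / 3) ^ 3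
        - (4 / 3 : ℂ) * (U τ + 4 * etaQuotient 56 (expFn [(2, 1), (4, -3), (8, 2), (14, 1), (28, -3), (56, 2)]) τ - 7 / 3) - 440 / 27
        = 4 * ((U τ - 2) ^ 2 * (U τ ^ 4 - 3 * U τ ^ 3 + 12 * U τ ^ 2 - 12 * U τ + 16)) / U τ ^ 3 := by
      rw [hinv]
      field_simp
      ring
    have h := hne τ
    rw [hid, div_eq_zero_iff] at h
    rcases h with h | h
    · have h' : (U τ - 2) ^ 2 * (U τ ^ 4 - 3 * U τ ^ 3 + 12 * U τ ^ 2 - 12 * U τ + 16) = 0 := by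
        simpa using h
      linear_combination h'
    · exact absurd h (pow_ne_zero _ hu)
  have hq := tendsto_qParam_zpow_atImInfty (m := 2) (by norm_num)
  have hUq : Tendsto (fun τ : ℍ ↦ U τ * Function.Periodic.qParam 1 (τ : ℂ) ^ (2 : ℤ)) atImInfty (𝓝 1) := by
    have h := tendsto_etaQuotient_div_qParam_zpow 56 (expFn [(2, -1), (4, 3), (8, -2), (14, -1), (28, 3), (56, -2)]) (-2) (by decide)
    refine h.congr fun τ ↦ ?_
    rw [hU, zpow_neg, div_inv_eq_mul]
  have h1 : Tendsto (fun τ : ℍ ↦ (U τ * Function.Periodic.qParam 1 (τ : ℂ) ^ (2 : ℤ)) ^ 6) atImInfty (𝓝 1) := by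
    simpa using hUq.pow 6
  have h2 : Tendsto (fun τ : ℍ ↦ (U τ * Function.Periodic.qParam 1 (τ : ℂ) ^ (2 : ℤ)) ^ 6) atImInfty (𝓝 0) := by
    set w : ℍ → ℂ := fun τ ↦ U τ * Function.Periodic.qParam 1 (τ : ℂ) ^ (2 : ℤ) with hw
    set s : ℍ → ℂ := fun τ ↦ Function.Periodic.qParam 1 (τ : ℂ) ^ (2 : ℤ) with hs
    have h := ((((((hUq.pow 5).mul hq).const_mul 7).sub (((hUq.pow 4).mul (hq.pow 2)).const_mul 28)).add
      (((hUq.pow 3).mul (hq.pow 3)).const_mul 72)).sub (((hUq.pow 2).mul (hq.pow 4)).const_mul 112)).add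
      (((hUq.mul (hq.pow 5)).const_mul 112).sub ((hq.pow 6).const_mul 64))
    simp only [one_pow, mul_zero, zero_pow, ne_eq, OfNat.ofNat_ne_zero, not_false_eq_true, sub_zero, add_zero] at h
    refine h.congr fun τ ↦ ?_
    rw [mul_pow _ _ 6, hx6]
    ring
  exact one_ne_zero (tendsto_nhds_unique h1 h2)

include hψ in
/-- **(S2)₅₆_b**: the period lattice of `ψ = P + Q` lies in the lattice of the Weierstrass pair with `g₂ = 4/3 = c₄/12`, `g₃ = 440/27 = c₆/216` of
`56b1 = [0, −1, 0, 0, −4]` (analytic bridge on `X = U + 4U⁻¹ − 7/3 = x_b − 1/3`: `(X′)² = (2πiψ)²(4X³ − (4/3)X − 440/27)` from (I2a), (I1) and (K)).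
[cite: CremonaAlgorithms1997, §2.10, Table 1 (56b1)] -/
theorem periodLatticeLe_fiftySixB :
    ∃ L₁ : PeriodPair, L₁.g₂ = 4 / 3 ∧ L₁.g₃ = 440 / 27 ∧ ∀ z ∈ periodLattice ψ, z ∈ L₁.lattice := by
  obtain ⟨L₁, hg2, hg3⟩ := PeriodPair.uniformization_holds (4 / 3) (440 / 27) (by norm_num)
  set U : ℍ → ℂ := etaQuotient 56 (expFn [(2, -1), (4, 3), (8, -2), (14, -1), (28, 3), (56, -2)]) with hU
  set Ui : ℍ → ℂ := etaQuotient 56 (expFn [(2, 1), (4, -3), (8, 2), (14, 1), (28, -3), (56, 2)]) with hUi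
  set V : ℍ → ℂ := etaQuotient 56 (expFn [(1, -1), (2, 2), (4, 1), (7, -1), (8, -2), (14, 2), (28, 1), (56, -2)]) with hV
  have hU0 : ∀ τ : ℍ, U τ ≠ 0 := fun τ ↦ etaQuotient_ne_zero 56 _ τ
  -- `ψ ≠ 0`: `(P + Q)/q → 1` at `i∞`
  have hne : ψ ≠ 0 := by
    intro h
    have hP := tendsto_etaQuotient_div_qParam_zpow 56 (expFn [(2, -1), (4, 3), (14, 3), (28, -1)]) 1 (by decide)
    have hQ := tendsto_etaQuotient_div_qParam_zpow 56 (expFn [(2, 3), (4, -1), (14, -1), (28, 3)]) 3 (by decide)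
    have hq := tendsto_qParam_zpow_atImInfty (m := 2) (by norm_num)
    have hlim : Tendsto (fun τ : ℍ ↦ ψ τ / Function.Periodic.qParam 1 (τ : ℂ) ^ (1 : ℤ)) atImInfty (𝓝 (1 + 1 * 0)) := by
      refine (hP.add (hQ.mul hq)).congr fun τ ↦ ?_
      have hqτ : Function.Periodic.qParam 1 (τ : ℂ) ≠ 0 := Complex.exp_ne_zero _
      rw [hψ]
      simp only [zpow_ofNat, pow_one]
      field_simp
    rw [h] at hlim
    simp only [CuspForm.zero_apply, zero_div, mul_zero, add_zero] at hlim
    exact zero_ne_one (tendsto_nhds_unique tendsto_const_nhds hlim)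
  have hUmd : MDifferentiable 𝓘(ℂ) 𝓘(ℂ) U := mdifferentiable_etaQuotient 56 _
  have hUimd : MDifferentiable 𝓘(ℂ) 𝓘(ℂ) Ui := mdifferentiable_etaQuotient 56 _
  have hmd : MDifferentiable 𝓘(ℂ) 𝓘(ℂ) (fun τ : ℍ ↦ U τ + 4 * Ui τ - 7 / 3) := (hUmd.add (hUimd.const_smul (4 : ℂ))).sub mdifferentiable_const
  obtain ⟨P', hP'⟩ := exists_cuspForm_P56
  obtain ⟨Q', hQ'⟩ := exists_cuspForm_Q56
  have hφ' : ⇑(P' - Q') = fun τ ↦ etaQuotient 56 (expFn [(2, -1), (4, 3), (14, 3), (28, -1)]) τ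
      - etaQuotient 56 (expFn [(2, 3), (4, -1), (14, -1), (28, 3)]) τ := by
    rw [CuspForm.coe_sub, hP', hQ']; rfl
  refine ⟨L₁, hg2, hg3, periodLattice_le_of_deriv_sq ψ hne L₁ _ hmd
    (fun γ τ ↦ by simp only [hU, hUi, U_smul γ γ.2 τ, Uinv_smul γ γ.2 τ]) ?_ (by
      rw [hg2, hg3]; simpa only [hU, hUi] using exists_Xb_nondegenerate)⟩
  intro τ
  have hu : U τ ≠ 0 := hU0 τ
  -- the derivative of `X = U + 4U⁻¹ − 7/3`
  have hUdiff := UpperHalfPlane.mdifferentiable_iff.mp hUmd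
  have hUat : DifferentiableAt ℂ (U ∘ ofComplex) (τ : ℂ) :=
    (hUdiff _ τ.im_pos).differentiableAt (isOpen_upperHalfPlaneSet.mem_nhds τ.im_pos)
  have hX_fun : ((fun σ : ℍ ↦ U σ + 4 * Ui σ - 7 / 3) ∘ ofComplex) = fun z ↦ (U ∘ ofComplex) z + 4 * ((U ∘ ofComplex) z)⁻¹ - 7 / 3 := by
    funext z; simp only [Function.comp_apply, hUi, hU, Uinv_eq_inv]
  have hUτ : (U ∘ ofComplex) τ ≠ 0 := by simp only [Function.comp_apply, ofComplex_apply]; exact hu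
  have hderiv : deriv ((fun σ : ℍ ↦ U σ + 4 * Ui σ - 7 / 3) ∘ ofComplex) τ
      = deriv (U ∘ ofComplex) τ * (1 - 4 * ((U τ) ^ 2)⁻¹) := by
    rw [hX_fun]
    have hd2 : DifferentiableAt ℂ (fun z ↦ ((U ∘ ofComplex) z)⁻¹) (τ : ℂ) := hUat.inv hUτ
    rw [deriv_sub_const, deriv_fun_add hUat (hd2.const_mul 4), deriv_const_mul 4 hd2, deriv_fun_inv'' hUat hUτ]
    simp only [Function.comp_apply, ofComplex_apply]
    field_simp
    ring
  have hD := deriv_U56_identity (P' - Q') hφ' τ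
  have hC := cubic56 τ
  have hK := identityK (P' - Q') ψ hφ' hψ τ
  rw [← hU, ← hV] at hD hC
  rw [← hU] at hK
  have hUiτ : Ui τ = (U τ)⁻¹ := by rw [hUi, hU]; exact Uinv_eq_inv τ
  rw [hderiv, hD, hg2, hg3, hUiτ]
  have hA : (-(2 * π * I * (P' - Q') τ) * (2 * (V τ - U τ)) * (1 - 4 * (U τ ^ 2)⁻¹)) ^ 2
      = 4 * (2 * π * I) ^ 2 * (P' - Q') τ ^ 2 * (V τ - U τ) ^ 2 * (U τ ^ 2 - 4) ^ 2 / U τ ^ 4 := by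
    field_simp
    ring
  have hB : (2 * π * I * ψ τ) ^ 2 * (4 * (U τ + 4 * (U τ)⁻¹ - 7 / 3) ^ 3 - 4 / 3 * (U τ + 4 * (U τ)⁻¹ - 7 / 3) - 440 / 27)
      = (2 * π * I) ^ 2 * ψ τ ^ 2 * (4 * ((U τ - 2) ^ 2 * (U τ ^ 4 - 3 * U τ ^ 3 + 12 * U τ ^ 2 - 12 * U τ + 16))) / U τ ^ 3 := by
    field_simp
    ring
  rw [hA, hB, div_eq_div_iff (pow_ne_zero _ hu) (pow_ne_zero _ hu)]
  linear_combination (4 * (2 * π * I) ^ 2 * (P' - Q') τ ^ 2 * (U τ ^ 2 - 4) ^ 2 * U τ ^ 3) * hC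
    + (4 * (2 * π * I) ^ 2 * U τ ^ 4 * (U τ - 2) ^ 2) * hK

end PhiPsi

end Summit.BirchSwinnertonDyer.BirchSwinnertonDyer.Theorems.ManinLocalTwoThree.EtaIdentityKFiftySix

end
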